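import Summits.Ventures.PercRepro.C026GluingCount
import Summits.Ventures.PercRepro.C026Hub

/-!
# Faces of a gluing are gluings; the composition theorem at every `p` (p6, gen 8; DRAFT)

The structural half of mine-3's remark §26.8 «if both parts range over face-closed (★)-families then
C-026 holds at every `p` on the glued family (its faces are gluings of faces)»:

* `IsGluing` is decidable on finite types (`decidableIsGluing`), so concrete gluings are instances
  by `decide` on `side`;
* `IsGluing.col_const_of_conn`: along a sure path through non-marks the colour is constant, hence
  **`isGluing_minor`**: every marked minor `G.minor u v` of a gluing is a gluing for
  `side' e := side e.1` (the marks of the minor are the sure classes of the marks);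
* `dFreeIneq_of_marks_eq`: the D-free inequality is trivial when two marks coincide (`bot = ∅`);
* **`c026_of_dFree_minors`**: the per-graph bridge — the D-free inequality on every marked minor gives
  C-026 at every `p` (`quadForm_nonneg_of_minors` + `cubeSumQuad_kernel26_nonneg_iff_M` +
  `card_botM_le_of_dFree`, as in p5's `c026_hub`);
* **`c026_of_gluing_minors`**: for a gluing, the D-free inequality on the two parts of every minor with
  distinct marks gives C-026 at every `p`.
-/

namespace PercRepro

namespace MultiGraph

section GluingMinor

variable {V E : Type*}

/-- `IsGluing` is decidable on finite types. -/
instance decidableIsGluing [Fintype V] [Fintype E] [DecidableEq V] (G : MultiGraph V E) (a b c : V)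
    (side : E → Bool) : Decidable (G.IsGluing a b c side) := by
  unfold IsGluing
  infer_instance

variable {G : MultiGraph V E} {a b c : V} {side : E → Bool}

/-- **The colour is constant along a sure path through non-marks**: if `y` and `y'` are joined in
`v` and every vertex joined to `y` is a non-mark, an edge at `y` and an edge at `y'` have the same
colour. -/
theorem IsGluing.col_const_of_conn (hg : G.IsGluing a b c side) {v : Config E} {y y' : V}
    (hyy' : G.Conn v y y') (hnm : ∀ z, G.Conn v y z → z ≠ a ∧ z ≠ b ∧ z ≠ c) {e e' : E}
    (he : G.EdgeAt e y) (he' : G.EdgeAt e' y') : side e = side e' := by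
  suffices key : ∀ f, G.EdgeAt f y' → side f = side e from (key e' he').symm
  refine Conn.induction (motive := fun z => ∀ f, G.EdgeAt f z → side f = side e) ?_ ?_ hyy'
  · intro f hf
    have hy := hnm y (Conn.refl _ _ _)
    exact hg.col_eq hy.1 hy.2.1 hy.2.2 hf he
  · intro z z' hyz hzz' ih f hf
    have hz' := hnm z' (hyz.tail hzz')
    obtain ⟨g, _, hend⟩ := hzz'
    have hj : G.Joins g z z' := hend
    have h1 : side f = side g := hg.col_eq hz'.1 hz'.2.1 hz'.2.2 hf (EdgeAt.of_joins_right hj)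
    exact h1.trans (ih g (EdgeAt.of_joins_left hj))

/-- **A marked minor of a gluing is a gluing** (for the inherited colouring): a non-mark sure class is
one-coloured. -/
theorem isGluing_minor (hg : G.IsGluing a b c side) (u v : Config E) :
    (G.minor u v).IsGluing (G.sureClass v a) (G.sureClass v b) (G.sureClass v c)
      (fun e => side e.1) := by
  intro q hqa hqb hqc e e' he he'
  obtain ⟨x, rfl⟩ := Quotient.exists_rep q
  -- every vertex sure-joined to `x` is a non-mark
  have hnm : ∀ z, G.Conn v x z → z ≠ a ∧ z ≠ b ∧ z ≠ c := by
    intro z hz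
    refine ⟨fun h => hqa ?_, fun h => hqb ?_, fun h => hqc ?_⟩
    · exact h ▸ ((G.sureClass_eq_iff v x z).mpr hz)
    · exact h ▸ ((G.sureClass_eq_iff v x z).mpr hz)
    · exact h ▸ ((G.sureClass_eq_iff v x z).mpr hz)
  -- an endpoint `y` of `e` and an endpoint `y'` of `e'` are sure-joined to `x`
  have hy : ∃ y, G.Conn v x y ∧ G.EdgeAt e.1 y := by
    rcases he with h | h
    · exact ⟨G.fst e.1, ((G.sureClass_eq_iff v _ _).mp h).symm, Or.inl rfl⟩
    · exact ⟨G.snd e.1, ((G.sureClass_eq_iff v _ _).mp h).symm, Or.inr rfl⟩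
  have hy' : ∃ y', G.Conn v x y' ∧ G.EdgeAt e'.1 y' := by
    rcases he' with h | h
    · exact ⟨G.fst e'.1, ((G.sureClass_eq_iff v _ _).mp h).symm, Or.inl rfl⟩
    · exact ⟨G.snd e'.1, ((G.sureClass_eq_iff v _ _).mp h).symm, Or.inr rfl⟩
  obtain ⟨y, hxy, hey⟩ := hy
  obtain ⟨y', hxy', hey'⟩ := hy'
  exact hg.col_const_of_conn (hxy.symm.trans hxy') (fun z hz => hnm z (hxy.trans hz)) hey hey'

variable [Fintype E] [DecidableEq E]

open Classical in
/-- The D-free inequality is trivial when two of the marks coincide: `bot` is empty. -/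
theorem dFreeIneq_of_marks_eq (G : MultiGraph V E) {a b c : V} (h : a = b ∨ a = c ∨ b = c) :
    G.DFreeIneq a b c := by
  unfold DFreeIneq
  have hempty : (Finset.univ.filter fun ω : Config E => G.BotM ω a b c) = ∅ := by
    refine Finset.filter_eq_empty_iff.mpr fun ω _ hω => ?_
    rcases h with rfl | rfl | rfl
    · exact hω.1.1 (Conn.refl _ _ _)
    · exact hω.1.2.1 (Conn.refl _ _ _)
    · exact hω.1.2.2 (Conn.refl _ _ _)
  rw [hempty, Finset.card_empty]
  exact Nat.zero_le _

/-- **The per-graph bridge**: the D-free inequality on every marked minor gives C-026 at every `p`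
(`(x + y₁)(y₁ + z) ≤ y₁ + y₂ + y₃`), as in p5's `c026_hub`. -/
theorem c026_of_dFree_minors (G : MultiGraph V E) (a b c : V)
    (h : ∀ u v : Config E, v ≤ u →
      (G.minor u v).DFreeIneq (G.sureClass v a) (G.sureClass v b) (G.sureClass v c))
    (p : E → ℝ) (hp : IsProb p) :
    (G.law3 p a b c 0 + G.law3 p a b c 1) * (G.law3 p a b c 1 + G.law3 p a b c 4) ≤
      G.law3 p a b c 1 + G.law3 p a b c 2 + G.law3 p a b c 3 := by
  have h' := G.quadForm_nonneg_of_minors hp ![a, b, c] kernel26 fun u v huv => by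
    classical
    rw [sureClass_vec]
    exact ((G.minor u v).cubeSumQuad_kernel26_nonneg_iff_M _ _ _).mpr
      ((G.minor u v).card_botM_le_of_dFree (h u v huv))
  rw [G.quadForm_kernel26] at h'
  linarith

/-- **The composition theorem at every `p`**: for a gluing, the D-free inequality on both parts of
every marked minor with distinct marks gives C-026 at every `p` (a minor with two coinciding marks
is trivially D-free). -/
theorem c026_of_gluing_minors (G : MultiGraph V E) (a b c : V) (side : E → Bool)
    (hg : G.IsGluing a b c side)
    (h : ∀ u v : Config E, v ≤ u → G.sureClass v a ≠ G.sureClass v b →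
      G.sureClass v a ≠ G.sureClass v c → G.sureClass v b ≠ G.sureClass v c →
      ((G.minor u v).part (fun e => side e.1) true).DFreeIneq
          (G.sureClass v a) (G.sureClass v b) (G.sureClass v c) ∧
        ((G.minor u v).part (fun e => side e.1) false).DFreeIneq
          (G.sureClass v a) (G.sureClass v b) (G.sureClass v c))
    (p : E → ℝ) (hp : IsProb p) :
    (G.law3 p a b c 0 + G.law3 p a b c 1) * (G.law3 p a b c 1 + G.law3 p a b c 4) ≤
      G.law3 p a b c 1 + G.law3 p a b c 2 + G.law3 p a b c 3 := by
  refine c026_of_dFree_minors G a b c (fun u v huv => ?_) p hp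
  by_cases hab : G.sureClass v a = G.sureClass v b
  · exact (G.minor u v).dFreeIneq_of_marks_eq (Or.inl hab)
  by_cases hac : G.sureClass v a = G.sureClass v c
  · exact (G.minor u v).dFreeIneq_of_marks_eq (Or.inr (Or.inl hac))
  by_cases hbc : G.sureClass v b = G.sureClass v c
  · exact (G.minor u v).dFreeIneq_of_marks_eq (Or.inr (Or.inr hbc))
  obtain ⟨h₁, h₀⟩ := h u v huv hab hac hbc
  exact dFreeIneq_of_gluing (G.minor u v) _ _ _ hab hac hbc (fun e => side e.1)
    (isGluing_minor hg u v) h₁ h₀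

end GluingMinor

end MultiGraph

end PercRepro
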